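import Literature.Barriers.ABC.BakerMethodBoundsSubexpProofs
import Literature.NumberTheory.DiophantineGeometry.AbcWave0BakerWustholzProofs
import HarnessLib

/-!
# Proofs for `BakerMethodBounds`: Pasten's Theorem 1.4 (1) from Baker–Wüstholz over `ℚ` and Theorem 2.5

`Literature/Barriers/ABC/BakerMethodBoundsArchimedeanProofs.lean` — a proofs companion of
`Literature/Barriers/ABC/BakerMethodBounds.lean`, for the named fact
`Literature.Barriers.ABC.pasten2024_thm_1_4_1` (H. Pasten, *The largest prime factor of `n² + 1`
and improvements on subexponential `ABC`*, Invent. Math. 236 (2024), Theorem 1.4 (1)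
[cite: Pasten2024, Theorem 1.4 (1)]): for coprime positive `a + b = c` with `a ≤ c^{1−η}`,
`log c ≤ η⁻¹ exp(κ √((log R) log₂ R))`, `R = rad(abc)`.

The companions `BakerMethodBoundsSubexpProofs.lean` / `BakerMethodBoundsProofs.lean` deduce
Theorem 1.4 (1) from Pasten's Theorem 2.1 (= Evertse–Győry, Thm 4.2.1 over `ℚ`, BOTH the
archimedean and the `p`-adic clause, named fact
`Literature.NumberTheory.DiophantineGeometry.Dioph.evertseGyory_thm_4_2_1_rat`, itself reduced in
the tree to Matveev 2000 and Yu 2007) and Theorem 2.5 (Shimura curves, named fact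
`Literature.NumberTheory.DiophantineGeometry.pasten2024_thm_2_5`). This file proves the SAME
conclusion from a smaller transcendence input:

* `pasten2024_thm_1_4_1_of_bakerWustholz_rat :
    baker_wustholz ℚ → pasten2024_thm_2_5 → pasten2024_thm_1_4_1`,

where `Literature.NumberTheory.DiophantineGeometry.baker_wustholz ℚ` is the Baker–Wüstholz
theorem of 1993 (= [BakerWustholz2007, Thm 7.1]) for logarithms of RATIONAL numbers — one
archimedean estimate, no `p`-adic logarithmic forms at all. The printed proof of part (1)
([Pasten2024, §4], p. 8) uses only the archimedean clause (i) of Theorem 2.1 together with "any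
exponential bound for the `ABC` conjecture (such as the one in [ABC1] which gives `K' = 15`)" to
control `h(ξ) = log c`; here

1. Theorem 2.1 (i) (constant `K^m`, from Matveev) is replaced by Baker–Wüstholz (constant
   `C(m, 1) = 18 (m+1)! m^{m+1} 32^{m+2} log 2m ≤ (64m)^{2m+5}`): since the number of
   generators is `m ≤ 1 + 4 √(log R / log₂ R)`, one still has `log C(m, 1) ≪ √((log R) log₂ R)`
   (`bwConstant_le_exp`), which is all the subexponential shape needs;
2. the exponential a-priori bound is not needed: Baker–Wüstholz carries `log(e B)` with
   `B = max |bᵢ|` the size of the exponents (not the height of `ξ`), and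
   `max_{p ∈ I} |e_p| ≤ ∏_{p ∣ abc} ν_p(abc) ≤ κ_{1/3} R³` is read off Theorem 2.5 itself
   (`natAbs_expDiff_le_exponentProduct`), so `log(e B) ≤ 5 log R`.

The linear form is `Λ = Log ξ₀ + ∑_{p ∈ I} e_p Log p = log(b/c)` for the splitting
`b/c = ξ₀ ∏_{p ∈ I} p^{e_p}` of `PastenSubexpDecomposition` (big primes `|e_p| > N = ⌊B⌋`,
cofactor `ξ₀`; `linearForm_eq`), `Λ ≠ 0` as `0 < b/c < 1`, and `|Λ| = log(c/b) ≤ 2a/c` when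
`c ≤ 2b` (otherwise `log(c/a) < log 2` trivially), whence
`log c − log a < log 2 + C(#I+1, 1) · max(1, h(ξ₀)) · ∏_{p ∈ I} h'(p) · log(e B)` (`arch_bound_bw`;
`h'(ξ₀) ≤ max(1, h(ξ₀))` because `|log ξ₀| ≤ h(ξ₀)` for a positive rational, and `αᵢ = 1` is
admissible in `baker_wustholz`, so no case distinction on `ξ₀ = 1` is needed). The bookkeeping
`max(1, h(ξ₀)) ≤ B²`, `∏ h'(p) ≤ (log R)^{#I} ≤ B⁸`, `#I · log B ≤ 4 log R` is that of
`PastenSubexpPlaces` (`theta_le_of_exponentProduct_le`), with the threshold `L⋆(K, κ)` of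
`PastenSubexpDecomposition` taken at `K = 1600` (so `log R ≥ 102400`); the outcome is
`η log c < B^{48}` (`thm_1_4_1_core_bw`), i.e. Theorem 1.4 (1) with `κ = 48` and
`R₀ = exp L⋆(1600, κ₁)`. Everything here is proved; there are no definitions and no new named
facts, and the undischarged trust base of `pasten2024_thm_1_4_1` along this route is exactly
`{baker_wustholz ℚ, pasten2024_thm_2_5}`. Finally, `pasten2024_thm_1_4_1_iff_log_sub_log_le`
records that the fact is equivalent (same `κ`, `R₀`) to the `η`-free bound
`log c − log a ≤ exp(κ √((log R) log₂ R))` for all abc triples with `rad(abc) ≥ R₀`.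

The sibling `BakerMethodBoundsBakerWustholzProofs.lean`, landed concurrently (same gate batch) by
the other seat of the same unit, proves the same implication independently as
`Literature.Barriers.ABC.pasten2024_thm_1_4_1_of_bakerWustholz` (`κ = 113`, threshold
`log R ≥ max(e, log k₁)`, via `BakerMethodBoundsProofs.lean` and an a-priori bound
`log log c ≤ 5 log R`); the present file goes through `BakerMethodBoundsSubexpProofs.lean`, bounds
the exponents directly, and its assembly theorem carries the suffix `_rat` so that the two leaf
modules can be imported together.

## References

* [Pasten2024] H. Pasten, *The largest prime factor of `n² + 1` and improvements on
  subexponential `ABC`*, Invent. Math. 236 (2024), 373–385, doi:10.1007/s00222-024-01244-6,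
  arXiv:2312.03566 — Theorem 1.4 (1), Theorem 2.1, Theorem 2.5, §4.
* [BakerWustholz2007] A. Baker, G. Wüstholz, *Logarithmic Forms and Diophantine Geometry*, New
  Mathematical Monographs 9, CUP 2007 — Thm 7.1 (= Baker–Wüstholz, J. reine angew. Math. 442
  (1993), 19–62, Theorem).
-/

noncomputable section

open Real Finset Height
open Literature.NumberTheory.DiophantineGeometry
open Literature.NumberTheory.DiophantineGeometry.Pasten

namespace Literature.Barriers.ABC

/-! ### Baker–Wüstholz over `ℚ`, for an arbitrary finite index type -/

/-- `[ℚ : ℚ] = 1`. [folklore] -/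
theorem finrank_rat_rat : (Module.finrank ℚ ℚ : ℝ) = 1 := by
  rw [Module.finrank_self]; norm_num

/-- The modified height over `ℚ`: `h'(q) = max (h(q), |log q|, 1)`. [folklore] -/
theorem bwHeight_rat (q : ℚ) :
    bwHeight (Rat.castHom ℂ) q = max (logHeight₁ q) (max ‖Complex.log (q : ℂ)‖ 1) := by
  unfold bwHeight
  rw [finrank_rat_rat, div_one, div_one, div_one]
  rfl

/-- **Baker–Wüstholz over `ℚ` for a family indexed by a finite type** (transfer of
`baker_wustholz ℚ` along `Fintype.equivFin`). [cite: BakerWustholz2007, Thm 7.1] -/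
theorem bw_rat_of_fintype (hBW : baker_wustholz ℚ) {ι : Type*} [Fintype ι] [DecidableEq ι]
    (α : ι → ℚ) (b : ι → ℤ) (hα : ∀ i, α i ≠ 0)
    (hΛ : ∑ i, (b i : ℂ) * Complex.log (α i : ℂ) ≠ 0) :
    -(bwConstant (Fintype.card ι) 1 * (∏ i, bwHeight (Rat.castHom ℂ) (α i)) *
        Real.log (Real.exp 1 * (Finset.univ.sup fun i => (b i).natAbs : ℕ))) <
      Real.log ‖∑ i, (b i : ℂ) * Complex.log (α i : ℂ)‖ := by
  set e := Fintype.equivFin ι with he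
  have hsum : ∑ i, ((b ∘ e.symm) i : ℂ) * Complex.log (Rat.castHom ℂ ((α ∘ e.symm) i)) =
      ∑ i, (b i : ℂ) * Complex.log (α i : ℂ) := by
    simp only [Function.comp, eq_ratCast]
    exact Equiv.sum_comp e.symm (fun i => (b i : ℂ) * Complex.log (α i : ℂ))
  have hprod : ∏ i, bwHeight (Rat.castHom ℂ) ((α ∘ e.symm) i) =
      ∏ i, bwHeight (Rat.castHom ℂ) (α i) := by
    simp only [Function.comp]
    exact Equiv.prod_comp e.symm (fun i => bwHeight (Rat.castHom ℂ) (α i))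
  have hsup : (Finset.univ.sup fun i => ((b ∘ e.symm) i).natAbs) =
      Finset.univ.sup fun i => (b i).natAbs := by
    rw [show (fun i => ((b ∘ e.symm) i).natAbs) = (fun i => (b i).natAbs) ∘ e.symm from rfl,
      ← Finset.sup_image, Finset.image_univ_equiv]
  have key := hBW (Rat.castHom ℂ) (α ∘ e.symm) (b ∘ e.symm) (fun i => hα _) (by rwa [hsum])
  rw [hsum, hprod, hsup, Module.finrank_self] at key
  exact key

/-! ### The modified height of positive rationals -/

/-- For a positive rational `q`: `|log q| ≤ h(q) = log max(num, den)`. [folklore] -/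
theorem abs_log_ratCast_le_logHeight₁ {q : ℚ} (hq : 0 < q) :
    |Real.log (q : ℝ)| ≤ logHeight₁ q := by
  rw [Rat.logHeight₁_eq_log_max]
  have hnum : 0 < q.num := Rat.num_pos.mpr hq
  have hden : 0 < q.den := q.den_pos
  have hnumR : (0 : ℝ) < q.num := by exact_mod_cast hnum
  have hdenR : (0 : ℝ) < q.den := by exact_mod_cast hden
  rw [Rat.cast_def q, Real.log_div hnumR.ne' hdenR.ne']
  set M : ℕ := max q.num.natAbs q.den with hM
  have h1 : (q.num : ℝ) ≤ (M : ℝ) := by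
    have h' : q.num ≤ (M : ℤ) := by
      rw [← Int.natAbs_of_nonneg hnum.le]
      exact_mod_cast le_max_left _ _
    exact_mod_cast h'
  have h2 : (q.den : ℝ) ≤ (M : ℝ) := by exact_mod_cast le_max_right _ _
  have hl1 : 0 ≤ Real.log (q.num : ℝ) := Real.log_nonneg (by exact_mod_cast hnum)
  have hl2 : 0 ≤ Real.log (q.den : ℝ) := Real.log_nonneg (by exact_mod_cast hden)
  have hm1 : Real.log (q.num : ℝ) ≤ Real.log (M : ℝ) := Real.log_le_log hnumR h1
  have hm2 : Real.log (q.den : ℝ) ≤ Real.log (M : ℝ) := Real.log_le_log hdenR h2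
  rw [abs_le]
  constructor <;> linarith

/-- For a positive rational `q`: `‖Log q‖ = |log q|` (principal complex logarithm of a positive
real). [folklore] -/
theorem norm_clog_ratCast_of_pos {q : ℚ} (hq : 0 < q) :
    ‖Complex.log (q : ℂ)‖ = |Real.log (q : ℝ)| := by
  have hq' : (0 : ℝ) ≤ (q : ℝ) := by exact_mod_cast hq.le
  rw [← Complex.ofReal_ratCast, ← Complex.ofReal_log hq', Complex.norm_real, Real.norm_eq_abs]

/-- For a positive rational `q`: `h'(q) ≤ max(1, h(q))`. [folklore] -/
theorem bwHeight_rat_le_of_pos {q : ℚ} (hq : 0 < q) :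
    bwHeight (Rat.castHom ℂ) q ≤ max 1 (logHeight₁ q) := by
  rw [bwHeight_rat, norm_clog_ratCast_of_pos hq]
  exact max_le (le_max_right _ _)
    (max_le ((abs_log_ratCast_le_logHeight₁ hq).trans (le_max_right _ _)) (le_max_left _ _))

/-- For a prime (indeed any positive integer) `p` with `log p ≤ L` and `1 ≤ L`: `h'(p) ≤ L`.
[folklore] -/
theorem bwHeight_natCast_le {p : ℕ} (hp : 0 < p) {L : ℝ} (hpL : Real.log p ≤ L) (hL : 1 ≤ L) :
    bwHeight (Rat.castHom ℂ) (p : ℚ) ≤ L := by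
  haveI : NeZero p := ⟨hp.ne'⟩
  refine (bwHeight_rat_le_of_pos (by exact_mod_cast hp)).trans (max_le hL ?_)
  rwa [Rat.logHeight₁_natCast]

/-- `0 < h'(q)`. [folklore] -/
theorem bwHeight_rat_pos (q : ℚ) : 0 < bwHeight (Rat.castHom ℂ) q :=
  bwHeight_pos _ _


/-! ### The linear form attached to `u/v = ξ₀ · ∏_{p ∈ I} p^{e_p}` -/

section linearForm

variable {u v : ℕ}

/-- For a non-negative rational `q`: `Log q = log q` (principal complex logarithm of a
non-negative real). [folklore] -/
theorem clog_ratCast_of_nonneg {q : ℚ} (hq : 0 ≤ q) :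
    Complex.log (q : ℂ) = ((Real.log (q : ℝ) : ℝ) : ℂ) := by
  have hq' : (0 : ℝ) ≤ (q : ℝ) := by exact_mod_cast hq
  rw [← Complex.ofReal_ratCast, ← Complex.ofReal_log hq']

/-- `log(u/v) = log ξ₀ + ∑_{p ∈ I} e_p log p` (real logarithms; `u, v` coprime positive).
[cite: Pasten2024, §4] -/
theorem log_cast_div_eq_log_cofactor_add_sum (hu : u ≠ 0) (hv : v ≠ 0) (huv : u.Coprime v)
    (N : ℕ) :
    Real.log ((u : ℝ) / v) = Real.log ((cofactor u v N : ℚ) : ℝ) +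
      ∑ p ∈ bigPrimes u v N, (expDiff u v p : ℝ) * Real.log p := by
  have key := cast_div_eq_cofactor_mul_prod hu hv huv N
  have key' : (u : ℝ) / v =
      ((cofactor u v N : ℚ) : ℝ) * ∏ p ∈ bigPrimes u v N, (p : ℝ) ^ expDiff u v p := by
    have := congrArg (fun q : ℚ => (q : ℝ)) key
    push_cast at this
    exact this
  have hξ₀ : (0 : ℝ) < ((cofactor u v N : ℚ) : ℝ) := by exact_mod_cast cofactor_pos u v N
  have hfac : ∀ p ∈ bigPrimes u v N, (p : ℝ) ^ expDiff u v p ≠ 0 := fun p hp =>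
    (zpow_pos (by exact_mod_cast (prime_of_mem_bigPrimes hp).pos) _).ne'
  rw [key', Real.log_mul hξ₀.ne' (Finset.prod_ne_zero_iff.mpr hfac), Real.log_prod hfac]
  congr 1
  exact Finset.sum_congr rfl fun p _ => Real.log_zpow _ _

/-- **The linear form in logarithms.** With generators `ξ₀` (coefficient `1`) and the big primes
`p ∈ I` (coefficients `e_p`), indexed by `Option I`:
`Λ = 1 · Log ξ₀ + ∑_{p ∈ I} e_p · Log p = log(u/v)` (as a complex number). [cite: Pasten2024, §4] -/
theorem linearForm_eq (hu : u ≠ 0) (hv : v ≠ 0) (huv : u.Coprime v) (N : ℕ) :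
    ∑ o : Option (bigPrimes u v N),
        ((o.elim (1 : ℤ) fun p => expDiff u v p : ℤ) : ℂ) *
          Complex.log ((o.elim (cofactor u v N) fun p => ((p : ℕ) : ℚ) : ℚ) : ℂ) =
      ((Real.log ((u : ℝ) / v) : ℝ) : ℂ) := by
  rw [Fintype.sum_option, log_cast_div_eq_log_cofactor_add_sum hu hv huv N]
  simp only [Option.elim]
  rw [clog_ratCast_of_nonneg (cofactor_pos u v N).le, Int.cast_one, one_mul, Complex.ofReal_add]
  congr 1
  rw [Complex.ofReal_sum, ← Finset.sum_coe_sort (bigPrimes u v N)]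
  refine Finset.sum_congr rfl fun p _ => ?_
  rw [clog_ratCast_of_nonneg (by positivity), Rat.cast_natCast]
  push_cast
  ring

end linearForm


/-! ### The archimedean bound for an abc triple from Baker–Wüstholz -/

section triple

variable {a b c : ℕ}

/-- `log(c/b) ≤ 2a/c` when `c ≤ 2b` (`log x ≤ x − 1` and `a/b ≤ 2a/c`). [folklore] -/
theorem log_div_le_two_mul_div (ha : 0 < a) (hb : 0 < b) (habc : a + b = c) (hcb : c ≤ 2 * b) :
    Real.log ((c : ℝ) / b) ≤ 2 * a / c := by
  have hb' : (0 : ℝ) < b := by exact_mod_cast hb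
  have hc' : (0 : ℝ) < c := by exact_mod_cast (show 0 < c by omega)
  have habc' : (a : ℝ) + b = c := by exact_mod_cast habc
  have hcb' : (c : ℝ) ≤ 2 * b := by exact_mod_cast hcb
  calc Real.log ((c : ℝ) / b) ≤ (c : ℝ) / b - 1 := Real.log_le_sub_one_of_pos (div_pos hc' hb')
    _ = a / b := by field_simp; linarith
    _ ≤ 2 * a / c := by
        rw [div_le_div_iff₀ hb' hc']
        have ha' : (0 : ℝ) ≤ a := Nat.cast_nonneg a
        nlinarith

/-- **Archimedean place, `ξ = b/c`, via Baker–Wüstholz over `ℚ`.** For an abc triple `a + b = c`,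
a threshold `N` (big primes `I = bigPrimes b c N`, cofactor `ξ₀`) and any `M ≥ 1` with
`|e_p| ≤ M` for `p ∈ I`:
`log c − log a < log 2 + C(#I + 1, 1) · (max(1, h(ξ₀)) · ∏_{p ∈ I} h'(p)) · log(e M)`.
The linear form is `Λ = Log ξ₀ + ∑_{p ∈ I} e_p Log p = log(b/c) ≠ 0`; if `c ≤ 2b` then
`|Λ| = log(c/b) ≤ 2a/c`, and if `c > 2b` then already `log c − log a < log 2`.
[cite: Pasten2024, §4] [cite: BakerWustholz2007, Thm 7.1] -/
theorem arch_bound_bw (hBW : baker_wustholz ℚ) (h : IsABCTriple a b c) (N : ℕ) {M : ℕ}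
    (hM1 : 1 ≤ M) (hM : ∀ p ∈ bigPrimes b c N, (expDiff b c p).natAbs ≤ M) :
    Real.log c - Real.log a < Real.log 2 +
      bwConstant ((bigPrimes b c N).card + 1) 1 *
        (max 1 (logHeight₁ (cofactor b c N)) *
          ∏ p ∈ bigPrimes b c N, bwHeight (Rat.castHom ℂ) (p : ℚ)) *
        Real.log (Real.exp 1 * M) := by
  obtain ⟨ha, hb, habc, hcop⟩ := id h
  have hc : 0 < c := by omega
  have ha' : (0 : ℝ) < a := by exact_mod_cast ha
  have hb' : (0 : ℝ) < b := by exact_mod_cast hb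
  have hc' : (0 : ℝ) < c := by exact_mod_cast hc
  have hbc : b.Coprime c := coprime_right_of_isABCTriple h
  set I := bigPrimes b c N with hI
  set ξ₀ : ℚ := cofactor b c N with hξ₀def
  have hM1' : (1 : ℝ) ≤ M := by exact_mod_cast hM1
  -- the main term is non-negative
  have hC0 : 0 ≤ bwConstant (I.card + 1) 1 := (bwConstant_pos (by omega) le_rfl).le
  have hprod0 : 0 ≤ ∏ p ∈ I, bwHeight (Rat.castHom ℂ) (p : ℚ) :=
    Finset.prod_nonneg fun p _ => (bwHeight_rat_pos _).le
  have hmax0 : (0 : ℝ) ≤ max 1 (logHeight₁ ξ₀) := zero_le_one.trans (le_max_left _ _)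
  have hlogM : 1 ≤ Real.log (Real.exp 1 * M) := by
    rw [Real.log_mul (Real.exp_pos 1).ne' (by positivity), Real.log_exp]
    linarith [Real.log_nonneg hM1']
  have hT0 : 0 ≤ bwConstant (I.card + 1) 1 *
      (max 1 (logHeight₁ ξ₀) * ∏ p ∈ I, bwHeight (Rat.castHom ℂ) (p : ℚ)) *
      Real.log (Real.exp 1 * M) := by positivity
  by_cases hcb : c ≤ 2 * b
  · -- the generators and coefficients, indexed by `Option I`
    set α : Option I → ℚ := fun o => o.elim ξ₀ fun p => ((p : ℕ) : ℚ) with hαdef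
    set β : Option I → ℤ := fun o => o.elim (1 : ℤ) fun p => expDiff b c p with hβdef
    have hα : ∀ o, α o ≠ 0 := by
      rintro (_ | p)
      · exact (cofactor_pos b c N).ne'
      · simp only [hαdef, Option.elim]
        exact_mod_cast (prime_of_mem_bigPrimes p.2).ne_zero
    have hΛ : ∑ o, (β o : ℂ) * Complex.log (α o : ℂ) = ((Real.log ((b : ℝ) / c) : ℝ) : ℂ) :=
      linearForm_eq hb.ne' hc.ne' hbc N
    have hlogbc : Real.log ((b : ℝ) / c) < 0 :=
      Real.log_neg (div_pos hb' hc') (by rw [div_lt_one hc']; exact_mod_cast (show b < c by omega))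
    have hΛ0 : ∑ o, (β o : ℂ) * Complex.log (α o : ℂ) ≠ 0 := by
      rw [hΛ]; exact_mod_cast hlogbc.ne
    have key := bw_rat_of_fintype hBW α β hα hΛ0
    -- identify the pieces
    have hcard : Fintype.card (Option I) = I.card + 1 := by
      rw [Fintype.card_option, Fintype.card_coe]
    have hprodα : ∏ o, bwHeight (Rat.castHom ℂ) (α o) =
        bwHeight (Rat.castHom ℂ) ξ₀ * ∏ p ∈ I, bwHeight (Rat.castHom ℂ) (p : ℚ) := by
      rw [Fintype.prod_option]
      simp only [hαdef, Option.elim]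
      rw [Finset.prod_coe_sort I fun p => bwHeight (Rat.castHom ℂ) (p : ℚ)]
    have hsup1 : 1 ≤ Finset.univ.sup fun o => (β o).natAbs :=
      le_trans (by simp [hβdef]) (Finset.le_sup (f := fun o => (β o).natAbs) (Finset.mem_univ none))
    have hsupM : (Finset.univ.sup fun o => (β o).natAbs) ≤ M := by
      refine Finset.sup_le ?_
      rintro (_ | p) -
      · simpa [hβdef] using hM1
      · simpa [hβdef] using hM p p.2
    have hnorm : ‖∑ o, (β o : ℂ) * Complex.log (α o : ℂ)‖ = Real.log ((c : ℝ) / b) := by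
      rw [hΛ, Complex.norm_real, Real.norm_eq_abs, abs_of_neg hlogbc, ← Real.log_inv, inv_div]
    rw [hcard, hprodα, hnorm] at key
    -- `log |Λ| ≤ log 2 + log a − log c`
    have hΛpos : 0 < Real.log ((c : ℝ) / b) :=
      Real.log_pos (by rw [one_lt_div hb']; exact_mod_cast (show b < c by omega))
    have hup : Real.log (Real.log ((c : ℝ) / b)) ≤ Real.log 2 + Real.log a - Real.log c := by
      calc Real.log (Real.log ((c : ℝ) / b)) ≤ Real.log (2 * a / c) :=
            Real.log_le_log hΛpos (log_div_le_two_mul_div ha hb habc hcb)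
        _ = Real.log 2 + Real.log a - Real.log c := by
            rw [Real.log_div (by positivity) hc'.ne', Real.log_mul two_ne_zero ha'.ne']
    -- monotonicity in the height of `ξ₀` and in `M`
    have hmono : bwConstant (I.card + 1) 1 *
        (bwHeight (Rat.castHom ℂ) ξ₀ * ∏ p ∈ I, bwHeight (Rat.castHom ℂ) (p : ℚ)) *
        Real.log (Real.exp 1 * (Finset.univ.sup fun o => (β o).natAbs : ℕ)) ≤
        bwConstant (I.card + 1) 1 *
        (max 1 (logHeight₁ ξ₀) * ∏ p ∈ I, bwHeight (Rat.castHom ℂ) (p : ℚ)) *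
        Real.log (Real.exp 1 * M) := by
      have h1 : bwHeight (Rat.castHom ℂ) ξ₀ ≤ max 1 (logHeight₁ ξ₀) :=
        bwHeight_rat_le_of_pos (cofactor_pos b c N)
      have hsup1' : (1 : ℝ) ≤ ((Finset.univ.sup fun o => (β o).natAbs : ℕ) : ℝ) := by
        exact_mod_cast hsup1
      have h2 : Real.log (Real.exp 1 * (Finset.univ.sup fun o => (β o).natAbs : ℕ)) ≤
          Real.log (Real.exp 1 * M) :=
        Real.log_le_log (by positivity)
          (mul_le_mul_of_nonneg_left (by exact_mod_cast hsupM) (Real.exp_pos 1).le)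
      have h3 : 0 ≤ Real.log (Real.exp 1 * (Finset.univ.sup fun o => (β o).natAbs : ℕ)) := by
        rw [Real.log_mul (Real.exp_pos 1).ne' (by positivity), Real.log_exp]
        linarith [Real.log_nonneg hsup1']
      apply mul_le_mul _ h2 h3 (by positivity)
      exact mul_le_mul_of_nonneg_left (mul_le_mul_of_nonneg_right h1 hprod0) hC0
    linarith
  · -- `c > 2b`: then `2a > c` and the bound is trivial
    push Not at hcb
    have h2a : (c : ℝ) < 2 * a := by exact_mod_cast (show c < 2 * a by omega)
    have hlt : Real.log c < Real.log 2 + Real.log a := by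
      rw [← Real.log_mul two_ne_zero ha'.ne']
      exact Real.log_lt_log hc' h2a
    linarith

end triple


/-! ### Bookkeeping: the Baker–Wüstholz constant `C(n, 1)` -/

/-- `C(n, 1) = 18 (n+1)! n^{n+1} 32^{n+2} log(2n) ≤ (64 n)^{2n+5}` for `n ≥ 1`
(`(n+1)! ≤ (n+1)^{n+1} ≤ (64n)^{n+1}`, `n^{n+1} 32^{n+2} ≤ (32n)^{n+2}`, `log(2n) ≤ 2n`).
[folklore] -/
theorem bwConstant_one_right_le {n : ℕ} (hn : 1 ≤ n) :
    bwConstant n 1 ≤ (64 * (n : ℝ)) ^ (2 * n + 5) := by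
  unfold bwConstant
  simp only [Nat.cast_one, mul_one]
  have hn' : (1 : ℝ) ≤ n := by exact_mod_cast hn
  have h18 : (18 : ℝ) ≤ 64 * n := by linarith
  have hfact : ((Nat.factorial (n + 1) : ℕ) : ℝ) ≤ (64 * (n : ℝ)) ^ (n + 1) := by
    calc ((Nat.factorial (n + 1) : ℕ) : ℝ) ≤ (((n + 1) ^ (n + 1) : ℕ) : ℝ) := by
          exact_mod_cast Nat.factorial_le_pow (n + 1)
      _ = ((n : ℝ) + 1) ^ (n + 1) := by push_cast; ring
      _ ≤ (64 * (n : ℝ)) ^ (n + 1) := pow_le_pow_left₀ (by positivity) (by linarith) _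
  have hpow : (n : ℝ) ^ (n + 1) * (32 : ℝ) ^ (n + 2) ≤ (64 * (n : ℝ)) ^ (n + 2) := by
    calc (n : ℝ) ^ (n + 1) * 32 ^ (n + 2) ≤ (n : ℝ) ^ (n + 2) * 32 ^ (n + 2) :=
          mul_le_mul_of_nonneg_right (pow_le_pow_right₀ hn' (by omega)) (by positivity)
      _ = (32 * (n : ℝ)) ^ (n + 2) := by rw [mul_pow]; ring
      _ ≤ (64 * (n : ℝ)) ^ (n + 2) := pow_le_pow_left₀ (by positivity) (by linarith) _
  have hlog : Real.log (2 * n) ≤ 64 * n := by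
    have := Real.log_le_sub_one_of_pos (show (0 : ℝ) < 2 * n by positivity)
    linarith
  have hlog0 : 0 ≤ Real.log (2 * n) := Real.log_nonneg (by linarith)
  calc 18 * ((Nat.factorial (n + 1) : ℕ) : ℝ) * (n : ℝ) ^ (n + 1) * 32 ^ (n + 2) * Real.log (2 * n)
      = 18 * ((Nat.factorial (n + 1) : ℕ) : ℝ) * ((n : ℝ) ^ (n + 1) * 32 ^ (n + 2)) *
          Real.log (2 * n) := by ring
    _ ≤ (64 * (n : ℝ)) * (64 * (n : ℝ)) ^ (n + 1) * (64 * (n : ℝ)) ^ (n + 2) * (64 * n) := by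
        apply mul_le_mul _ hlog hlog0 (by positivity)
        apply mul_le_mul _ hpow (by positivity) (by positivity)
        exact mul_le_mul h18 hfact (by positivity) (by positivity)
    _ = (64 * (n : ℝ)) ^ (2 * n + 5) := by ring

/-- **The constant against the threshold.** For `L ≥ L⋆(K, κ)` with `K ≥ 1600` (so `L ≥ 102400`,
`s = √(L log L) ≥ 320`) and `t s ≤ 4L` (`t` = number of big primes):
`C(t+1, 1) ≤ exp(35 s)` (as `n = t + 1` has `n s ≤ 5L`, `64 n ≤ L`, `n log L ≤ 5 s`, whence
`log C(n,1) ≤ (2n+5) log(64n) ≤ 7 n log L ≤ 35 s`). [folklore] -/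
theorem bwConstant_le_exp {K κ L : ℝ} (hK : 1600 ≤ K) (hL : Lstar K κ ≤ L) {t : ℕ}
    (ht : t * Real.sqrt (L * Real.log L) ≤ 4 * L) :
    bwConstant (t + 1) 1 ≤ Real.exp (35 * Real.sqrt (L * Real.log L)) := by
  set s := Real.sqrt (L * Real.log L) with hs
  have hL0 : 0 < L := pos_of_Lstar_le hL
  have hlogL : 1 ≤ Real.log L := one_le_log_of_Lstar_le hL
  have hs0 : 0 < s := sqrt_mul_log_pos_of_Lstar_le hL
  have hbig : 102400 ≤ L := by linarith [sixtyFour_mul_le_of_Lstar_le hL]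
  have hs2 : s ^ 2 = L * Real.log L := sq_sqrt_mul_log_of_Lstar_le hL
  have hs320 : 320 ≤ s := by
    have h1 : (320 : ℝ) ^ 2 ≤ L * Real.log L := by nlinarith
    calc (320 : ℝ) = Real.sqrt ((320 : ℝ) ^ 2) := by rw [Real.sqrt_sq]; norm_num
      _ ≤ s := by rw [hs]; exact Real.sqrt_le_sqrt h1
  have hsL : s ≤ L := by linarith [twelve_mul_sqrt_mul_log_le_of_Lstar_le hL, hs0]
  set n : ℕ := t + 1 with hn
  have hn1 : (1 : ℝ) ≤ n := by rw [hn]; push_cast; linarith [(Nat.cast_nonneg t : (0 : ℝ) ≤ t)]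
  have hncast : (n : ℝ) = t + 1 := by rw [hn]; push_cast; ring
  -- `n s ≤ 5 L`
  have hns : (n : ℝ) * s ≤ 5 * L := by rw [hncast]; nlinarith
  -- `64 n ≤ L`
  have h64 : 64 * (n : ℝ) ≤ L := by
    have h1 : 64 * (n : ℝ) * s ≤ L * s := by nlinarith
    exact le_of_mul_le_mul_right h1 hs0
  -- `n log L ≤ 5 s`
  have hnlog : (n : ℝ) * Real.log L ≤ 5 * s := by
    have h1 : (n : ℝ) * Real.log L * s ≤ 5 * s * s := by
      calc (n : ℝ) * Real.log L * s = (n : ℝ) * s * Real.log L := by ring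
        _ ≤ 5 * L * Real.log L := mul_le_mul_of_nonneg_right hns (by linarith)
        _ = 5 * s * s := by rw [mul_assoc 5 s s, ← pow_two, hs2]; ring
    exact le_of_mul_le_mul_right h1 hs0
  have h64n0 : (0 : ℝ) < 64 * n := by positivity
  calc bwConstant n 1 ≤ (64 * (n : ℝ)) ^ (2 * n + 5) := bwConstant_one_right_le (by omega)
    _ = Real.exp (((2 * n + 5 : ℕ) : ℝ) * Real.log (64 * n)) := by
        rw [Real.exp_nat_mul, Real.exp_log h64n0]
    _ ≤ Real.exp (35 * s) := by
        apply Real.exp_le_exp.mpr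
        have hlog64 : Real.log (64 * n) ≤ Real.log L := Real.log_le_log h64n0 h64
        have hlog64' : 0 ≤ Real.log (64 * n) := Real.log_nonneg (by linarith)
        calc (((2 * n + 5 : ℕ) : ℝ)) * Real.log (64 * n) ≤ (7 * (n : ℝ)) * Real.log L := by
              apply mul_le_mul _ hlog64 hlog64' (by positivity)
              push_cast; linarith
          _ = 7 * ((n : ℝ) * Real.log L) := by ring
          _ ≤ 7 * (5 * s) := by linarith
          _ = 35 * s := by ring

/-! ### Bookkeeping for an abc triple: exponents, heights, and the main term -/

section mainTerm

variable {a b c : ℕ}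

/-- For a big prime `p` of `b/c`: `|e_p| = ν_p(bc) ≤ ∏_{q ∣ abc} ν_q(abc)`. [cite: Pasten2024, §4] -/
theorem natAbs_expDiff_le_exponentProduct (h : IsABCTriple a b c) {N p : ℕ}
    (hp : p ∈ bigPrimes b c N) : (expDiff b c p).natAbs ≤ exponentProduct (a * b * c) := by
  obtain ⟨ha, hb, habc, hcop⟩ := id h
  have hc : c ≠ 0 := by omega
  have hbc : b.Coprime c := coprime_right_of_isABCTriple h
  have hac : a.Coprime c := coprime_left_of_isABCTriple h
  have hcop' : (b * c).Coprime a := Nat.Coprime.mul_left hcop.symm hac.symm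
  rw [natAbs_expDiff hb.ne' hc hbc p]
  have h1 : (b * c).factorization p ≤ ∏ q ∈ bigPrimes b c N, (b * c).factorization q := by
    refine Nat.le_of_dvd (Finset.prod_pos fun q hq => ?_) (Finset.dvd_prod_of_mem _ hp)
    exact lt_of_le_of_lt (Nat.zero_le N) (lt_factorization_of_mem_bigPrimes hb.ne' hc hbc hq)
  have h2 := prod_bigPrimes_le_exponentProduct hb.ne' hc ha.ne' hcop' N
  rw [show b * c * a = a * b * c by ring] at h2
  exact h1.trans h2

/-- **The main term is at most `B^{47}`.** For an abc triple with `L = log rad(abc) ≥ L⋆(K, κ)`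
(`K ≥ 1600`), `∏ ν_p(abc) ≤ κ rad(abc)³` and `N = ⌊B⌋`, `B = exp √(L log L)`:
`C(#I+1, 1) · (max(1, h(ξ₀)) · ∏_{p ∈ I} h'(p)) · log(e · max(1, ∏ ν_p(abc))) ≤ B^{47}`
(`C ≤ B^{35}`, `max(1, h(ξ₀)) ≤ B²`, `∏ h'(p) ≤ L^{#I} ≤ B^{8}`, `log(e M) ≤ 5L ≤ B²`).
[cite: Pasten2024, §4] -/
theorem mainTerm_le {K κ : ℝ} (hK : 1600 ≤ K) (hκ : 1 ≤ κ) (h : IsABCTriple a b c)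
    (hL : Lstar K κ ≤ Real.log (rad a b c : ℕ))
    (hE : (exponentProduct (a * b * c) : ℝ) ≤ κ * (rad a b c : ℝ) ^ 3) :
    bwConstant ((bigPrimes b c ⌊bfun (rad a b c : ℕ)⌋₊).card + 1) 1 *
        (max 1 (logHeight₁ (cofactor b c ⌊bfun (rad a b c : ℕ)⌋₊)) *
          ∏ p ∈ bigPrimes b c ⌊bfun (rad a b c : ℕ)⌋₊, bwHeight (Rat.castHom ℂ) (p : ℚ)) *
        Real.log (Real.exp 1 * (max 1 (exponentProduct (a * b * c)) : ℕ)) ≤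
      bfun (rad a b c : ℕ) ^ 47 := by
  obtain ⟨ha, hb, habc, hcop⟩ := id h
  set R : ℝ := ((rad a b c : ℕ) : ℝ) with hR
  set L : ℝ := Real.log R with hLdef
  set s : ℝ := Real.sqrt (L * Real.log L) with hs
  have hB : bfun R = Real.exp s := rfl
  set N : ℕ := ⌊bfun R⌋₊ with hN
  set I := bigPrimes b c N with hI
  set M : ℕ := max 1 (exponentProduct (a * b * c)) with hMdef
  have hc : 0 < c := by omega
  have hK1 : 1 ≤ K := le_trans (by norm_num) hK
  have hR0 : 0 < R := by rw [hR, rad_def]; exact_mod_cast Nat.radical_pos _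
  have hR1 : 1 ≤ R := by rw [hR]; exact_mod_cast Nat.radical_pos _
  have hL1 : 1 ≤ L := one_le_of_Lstar_le hL
  have hs0 : 0 < s := sqrt_mul_log_pos_of_Lstar_le hL
  have hbc : b.Coprime c := coprime_right_of_isABCTriple h
  have hac : a.Coprime c := coprime_left_of_isABCTriple h
  have hcop' : (b * c).Coprime a := Nat.Coprime.mul_left hcop.symm hac.symm
  have hrad : ((UniqueFactorizationMonoid.radical (b * c * a) : ℕ) : ℝ) = R := by
    rw [hR, rad_def, show b * c * a = a * b * c by ring]
  -- Step 1: `(N+1)^{#I} ≤ ∏ ν ≤ κ R³`, hence `#I · s ≤ 4 L`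
  have h1 : (N + 1) ^ I.card ≤ exponentProduct (a * b * c) := by
    have := pow_card_bigPrimes_le_exponentProduct hb.ne' hc.ne' hbc ha.ne' hcop' N
    rwa [show b * c * a = a * b * c by ring] at this
  have hBN : Real.exp s ≤ (N : ℝ) + 1 := by
    have := Nat.lt_floor_add_one (bfun R)
    rw [hB] at this
    exact this.le
  have h1' : Real.exp s ^ I.card ≤ κ * R ^ 3 := by
    calc Real.exp s ^ I.card ≤ ((N : ℝ) + 1) ^ I.card :=
          pow_le_pow_left₀ (Real.exp_pos s).le hBN _
      _ = (((N + 1) ^ I.card : ℕ) : ℝ) := by push_cast; ring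
      _ ≤ exponentProduct (a * b * c) := by exact_mod_cast h1
      _ ≤ κ * R ^ 3 := hE
  have hκ0 : 0 < κ := lt_of_lt_of_le one_pos hκ
  have hlogκ : Real.log κ ≤ L := le_of_max_le_right hL
  have hts : I.card * s ≤ 4 * L := by
    have hlog := Real.log_le_log (pow_pos (Real.exp_pos s) I.card) h1'
    rw [← Real.exp_nat_mul, Real.log_exp, Real.log_mul hκ0.ne' (pow_pos hR0 3).ne',
      Real.log_pow] at hlog
    push_cast at hlog
    linarith
  -- Step 2: `log(e M) ≤ 5 L`
  have hM1 : (1 : ℝ) ≤ M := by rw [hMdef]; exact_mod_cast le_max_left _ _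
  have hMR : (M : ℝ) ≤ κ * R ^ 3 := by
    rw [hMdef, Nat.cast_max, Nat.cast_one]
    refine max_le ?_ hE
    have : (1 : ℝ) ≤ R ^ 3 := one_le_pow₀ hR1
    nlinarith
  have hlogM : Real.log (Real.exp 1 * M) ≤ 5 * L := by
    have hM0 : (0 : ℝ) < M := by linarith
    rw [Real.log_mul (Real.exp_pos 1).ne' hM0.ne', Real.log_exp]
    have : Real.log M ≤ Real.log κ + 3 * L := by
      calc Real.log M ≤ Real.log (κ * R ^ 3) := Real.log_le_log hM0 hMR
        _ = Real.log κ + 3 * L := by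
            rw [Real.log_mul hκ0.ne' (pow_pos hR0 3).ne', Real.log_pow]; push_cast; ring
    linarith
  have hlogM0 : 0 ≤ Real.log (Real.exp 1 * M) := by
    rw [Real.log_mul (Real.exp_pos 1).ne' (by positivity), Real.log_exp]
    linarith [Real.log_nonneg hM1]
  -- Step 3: the heights
  have hprodH : ∏ p ∈ I, bwHeight (Rat.castHom ℂ) (p : ℚ) ≤ L ^ I.card := by
    rw [← Finset.prod_const]
    refine Finset.prod_le_prod (fun p _ => (bwHeight_rat_pos _).le) fun p hp => ?_
    have hp' := prime_of_mem_bigPrimes hp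
    refine bwHeight_natCast_le hp'.pos ?_ hL1
    have hple : (p : ℝ) ≤ R := by
      rw [← hrad]; exact_mod_cast le_radical_of_mem_bigPrimes hb.ne' hc.ne' ha.ne' hp
    exact Real.log_le_log (by exact_mod_cast hp'.pos) hple
  have hprodH0 : 0 ≤ ∏ p ∈ I, bwHeight (Rat.castHom ℂ) (p : ℚ) :=
    Finset.prod_nonneg fun p _ => (bwHeight_rat_pos _).le
  have hLB : L ≤ Real.exp s := le_exp_sqrt_mul_log_of_Lstar_le hL
  have hNB : (N : ℝ) ≤ Real.exp s := by
    rw [hN, hB]; exact Nat.floor_le (Real.exp_pos s).le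
  have hB1 : 1 ≤ Real.exp s := by linarith
  have hmaxH : max 1 (logHeight₁ (cofactor b c N)) ≤ Real.exp s * Real.exp s := by
    have hprod0 : 0 < ∏ p ∈ (b * c).primeFactors, (p : ℝ) :=
      Finset.prod_pos fun p hp => by exact_mod_cast (Nat.prime_of_mem_primeFactors hp).pos
    have hle : (∏ p ∈ (b * c).primeFactors, (p : ℝ)) ≤ R := by
      rw [← hrad]; exact prod_primeFactors_le_radical hb.ne' hc.ne' ha.ne'
    have hcof : logHeight₁ (cofactor b c N) ≤ N * L :=
      (logHeight₁_cofactor_le b c N).trans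
        (mul_le_mul_of_nonneg_left (Real.log_le_log hprod0 hle) (Nat.cast_nonneg N))
    exact max_le (by nlinarith) (hcof.trans (mul_le_mul hNB hLB (by linarith) (Real.exp_pos s).le))
  have hKL : (K * L) ^ I.card ≤ Real.exp (8 * s) := mul_pow_le_exp_of_Lstar_le hK1 hL hts
  have hLt : L ^ I.card ≤ Real.exp (8 * s) := by
    refine le_trans (pow_le_pow_left₀ (by linarith) ?_ _) hKL
    exact le_mul_of_one_le_left (by linarith) hK1
  -- Step 4: the constant and `5 L ≤ B²`
  have hC : bwConstant (I.card + 1) 1 ≤ Real.exp (35 * s) := bwConstant_le_exp hK hL hts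
  have hC0 : 0 ≤ bwConstant (I.card + 1) 1 := (bwConstant_pos (by omega) le_rfl).le
  have h5 : 5 * K * L ≤ Real.exp s ^ 2 := const_mul_mul_le_exp_sq hK1 hL (by norm_num)
  have h5L : 5 * L ≤ Real.exp s ^ 2 := le_trans (by nlinarith) h5
  -- assembly
  have hmid : max 1 (logHeight₁ (cofactor b c N)) * ∏ p ∈ I, bwHeight (Rat.castHom ℂ) (p : ℚ) ≤
      Real.exp s * Real.exp s * Real.exp (8 * s) :=
    mul_le_mul hmaxH (hprodH.trans hLt) hprodH0 (by positivity)
  have hmid0 : 0 ≤ max 1 (logHeight₁ (cofactor b c N)) *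
      ∏ p ∈ I, bwHeight (Rat.castHom ℂ) (p : ℚ) :=
    mul_nonneg (zero_le_one.trans (le_max_left _ _)) hprodH0
  have e35 : Real.exp (35 * s) = Real.exp s ^ 35 := by
    rw [show (35 : ℝ) * s = ((35 : ℕ) : ℝ) * s by norm_num, Real.exp_nat_mul]
  have e8 : Real.exp (8 * s) = Real.exp s ^ 8 := by
    rw [show (8 : ℝ) * s = ((8 : ℕ) : ℝ) * s by norm_num, Real.exp_nat_mul]
  calc bwConstant (I.card + 1) 1 *
        (max 1 (logHeight₁ (cofactor b c N)) * ∏ p ∈ I, bwHeight (Rat.castHom ℂ) (p : ℚ)) *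
        Real.log (Real.exp 1 * M)
      ≤ Real.exp (35 * s) * (Real.exp s * Real.exp s * Real.exp (8 * s)) * Real.exp s ^ 2 := by
        apply mul_le_mul (mul_le_mul hC hmid hmid0 (by positivity)) (hlogM.trans h5L) hlogM0
          (by positivity)
    _ = Real.exp s ^ 47 := by rw [e35, e8]; ring

end mainTerm


/-! ### Theorem 1.4 (1): core form and assembly -/

section core

variable {a b c : ℕ}

/-- **Theorem 1.4 (1), core form, from Baker–Wüstholz over `ℚ`.** For an abc triple with
`L = log R ≥ L⋆(K, κ)` (`K ≥ 1600`), `∏ ν_p(abc) ≤ κ R³`, and `a ≤ c^{1−η}` with `η > 0`: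
`log c < η⁻¹ · B^{48}`, `B = exp √((log R) log₂ R)`. (`η log c ≤ log c − log a <
log 2 + (main term) ≤ log 2 + B^{47} ≤ B^{48}`.) [cite: Pasten2024, Theorem 1.4 (1)] -/
theorem thm_1_4_1_core_bw {K κ : ℝ} (hBW : baker_wustholz ℚ) (hK : 1600 ≤ K) (hκ : 1 ≤ κ)
    (h : IsABCTriple a b c) (hL : Lstar K κ ≤ Real.log (rad a b c : ℕ))
    (hE : (exponentProduct (a * b * c) : ℝ) ≤ κ * (rad a b c : ℝ) ^ 3)
    {η : ℝ} (hη : 0 < η) (hac : (a : ℝ) ≤ (c : ℝ) ^ (1 - η)) :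
    Real.log c < η⁻¹ * bfun (rad a b c : ℕ) ^ 48 := by
  have hT := mainTerm_le hK hκ h hL hE
  have harch := arch_bound_bw hBW h ⌊bfun (rad a b c : ℕ)⌋₊
    (le_max_left 1 (exponentProduct (a * b * c)))
    (fun p hp => (natAbs_expDiff_le_exponentProduct h hp).trans (le_max_right _ _))
  obtain ⟨ha, hb, habc, hcop⟩ := id h
  set R : ℝ := ((rad a b c : ℕ) : ℝ) with hR
  set L : ℝ := Real.log R with hLdef
  set s : ℝ := Real.sqrt (L * Real.log L) with hs
  have hB : bfun R = Real.exp s := rfl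
  set y : ℝ := Real.log c with hy
  have hc : 0 < c := by omega
  have ha' : (0 : ℝ) < a := by exact_mod_cast ha
  have hc' : (0 : ℝ) < c := by exact_mod_cast hc
  have hLB : L ≤ Real.exp s := le_exp_sqrt_mul_log_of_Lstar_le hL
  have hB2 : 2 ≤ Real.exp s := by linarith [large_le_of_Lstar_le hL]
  have hB1 : 1 ≤ Real.exp s := by linarith
  have hloga : Real.log a ≤ (1 - η) * y := by
    have := Real.log_le_log ha' hac
    rwa [Real.log_rpow hc'] at this
  have hT' := hT.trans_eq (show bfun R ^ 47 = Real.exp s ^ 47 from rfl)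
  have hmain : η * y < Real.exp s ^ 48 := by
    have hlog2 : Real.log 2 ≤ 1 := by
      have := Real.log_two_lt_d9; linarith
    have hp47 : 1 ≤ Real.exp s ^ 47 := one_le_pow₀ hB1
    calc η * y ≤ y - Real.log a := by linarith
      _ < Real.log 2 + Real.exp s ^ 47 := by linarith
      _ ≤ Real.exp s ^ 47 + Real.exp s ^ 47 := by linarith
      _ = 2 * Real.exp s ^ 47 := by ring
      _ ≤ Real.exp s * Real.exp s ^ 47 := mul_le_mul_of_nonneg_right hB2 (by positivity)
      _ = Real.exp s ^ 48 := by ring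
  calc y = η⁻¹ * (η * y) := by field_simp
    _ < η⁻¹ * Real.exp s ^ 48 := mul_lt_mul_of_pos_left hmain (inv_pos.mpr hη)

end core

/-- **Pasten 2024, Theorem 1.4 (1), from Baker–Wüstholz 1993 over `ℚ` and Theorem 2.5.**
If `baker_wustholz ℚ` (lower bounds for linear forms in complex logarithms of rational numbers,
Baker–Wüstholz, J. reine angew. Math. 442 (1993) = [BakerWustholz2007, Thm 7.1]) and Pasten's
Shimura-curve bound `pasten2024_thm_2_5` hold, then `pasten2024_thm_1_4_1` holds, with `κ = 48`
and `R₀ = exp L⋆(1600, κ₁)`. No `p`-adic input is used: the exponential a-priori bound of the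
printed proof ([Pasten2024, §4], "any exponential bound for ABC", there taken from
Stewart–Tijdeman) is replaced by `max |e_p| ≤ ∏ ν_p(abc) ≤ κ₁ R³`, read off Theorem 2.5 itself.
(Same implication, proved independently with `κ = 113`, as
`pasten2024_thm_1_4_1_of_bakerWustholz` of the concurrently landed sibling
`BakerMethodBoundsBakerWustholzProofs.lean`; the suffix `_rat` keeps the two names distinct.)
[cite: Pasten2024, Theorem 1.4 (1)] [cite: BakerWustholz2007, Thm 7.1] -/
theorem pasten2024_thm_1_4_1_of_bakerWustholz_rat (hBW : baker_wustholz ℚ)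
    (hSh : pasten2024_thm_2_5) : pasten2024_thm_1_4_1 := by
  obtain ⟨κ₁, hκ₁, hin⟩ := inputs_of_facts 1600 hSh
  refine ⟨48, by norm_num, Real.exp (Lstar 1600 κ₁), fun a b c h hR η hη hac => ?_⟩
  obtain ⟨hL, hE⟩ := hin a b c h hR
  have := thm_1_4_1_core_bw hBW le_rfl hκ₁ h hL hE hη hac
  rw [show (48 : ℝ) = ((48 : ℕ) : ℝ) by norm_num, ← sfun_def, ← bfun_pow]
  exact this.le


/-! ### An `η`-free form of Theorem 1.4 (1) -/

/-- **Theorem 1.4 (1) is the bound `log(c/a) ≤ exp(κ √((log R) log₂ R))`.** The statement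
`pasten2024_thm_1_4_1` ("if `a ≤ c^{1−η}` with `η > 0` then `log c ≤ η⁻¹ exp(κ √((log R) log₂ R))`")
is equivalent, with the same `κ` and `R₀`, to the `η`-free bound
`log c − log a ≤ exp(κ √((log R) log₂ R))` for all abc triples with `rad(abc) ≥ R₀`: in one
direction `η log c ≤ log c − log a` whenever `a ≤ c^{1−η}`; in the other take
`η = (log c − log a)/log c`, for which `c^{1−η} = a`. (This is the form in which the printed proof
argues: "`η · log c ≤ log(c/a) = −log|1 − ξ| ≤ …`" [cite: Pasten2024, §4].) [cite: Pasten2024, Theorem 1.4 (1)] -/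
theorem pasten2024_thm_1_4_1_iff_log_sub_log_le :
    pasten2024_thm_1_4_1 ↔
      ∃ κ : ℝ, 0 < κ ∧ ∃ R₀ : ℝ, ∀ a b c : ℕ, IsABCTriple a b c → R₀ ≤ (rad a b c : ℝ) →
        Real.log c - Real.log a ≤
          Real.exp (κ * Real.sqrt (Real.log (rad a b c : ℕ) * Real.log (Real.log (rad a b c : ℕ)))) := by
  constructor
  · rintro ⟨κ, hκ, R₀, h⟩
    refine ⟨κ, hκ, R₀, fun a b c ht hR => ?_⟩
    obtain ⟨ha, hb, habc, -⟩ := id ht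
    have ha' : (0 : ℝ) < a := by exact_mod_cast ha
    have hc' : (0 : ℝ) < c := by exact_mod_cast (show 0 < c by omega)
    have hac : (a : ℝ) < c := by exact_mod_cast (show a < c by omega)
    have hy : 0 < Real.log c := Real.log_pos (by exact_mod_cast (show 1 < c by omega))
    have hd : 0 < Real.log c - Real.log a := by linarith [Real.log_lt_log ha' hac]
    set η : ℝ := (Real.log c - Real.log a) / Real.log c with hη
    have hη0 : 0 < η := div_pos hd hy
    have hpow : (a : ℝ) ≤ (c : ℝ) ^ (1 - η) := by
      have : (c : ℝ) ^ (1 - η) = a := by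
        rw [Real.rpow_def_of_pos hc', hη]
        field_simp
        rw [show Real.log c - (Real.log c - Real.log a) = Real.log a by ring, Real.exp_log ha']
      rw [this]
    have key := h a b c ht hR η hη0 hpow
    -- `log c ≤ η⁻¹ E` with `η⁻¹ = log c / (log c − log a)` gives `log c − log a ≤ E`
    have hinv : η⁻¹ = Real.log c / (Real.log c - Real.log a) := by rw [hη, inv_div]
    rw [hinv, div_mul_eq_mul_div, le_div_iff₀ hd] at key
    exact le_of_mul_le_mul_left (by linarith) hy
  · rintro ⟨κ, hκ, R₀, h⟩
    refine ⟨κ, hκ, R₀, fun a b c ht hR η hη hac => ?_⟩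
    obtain ⟨ha, hb, habc, -⟩ := id ht
    have ha' : (0 : ℝ) < a := by exact_mod_cast ha
    have hc' : (0 : ℝ) < c := by exact_mod_cast (show 0 < c by omega)
    have key := h a b c ht hR
    have hloga : Real.log a ≤ (1 - η) * Real.log c := by
      have := Real.log_le_log ha' hac
      rwa [Real.log_rpow hc'] at this
    have hmain : η * Real.log c ≤
        Real.exp (κ * Real.sqrt (Real.log (rad a b c : ℕ) * Real.log (Real.log (rad a b c : ℕ)))) := by
      linarith
    calc Real.log c = η⁻¹ * (η * Real.log c) := by field_simp
      _ ≤ η⁻¹ * Real.exp (κ * Real.sqrt (Real.log (rad a b c : ℕ) *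
            Real.log (Real.log (rad a b c : ℕ)))) :=
          mul_le_mul_of_nonneg_left hmain (inv_pos.mpr hη).le

end Literature.Barriers.ABC

end
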